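import Mathlib

/-!
# Transfer lemma, entropy accounting: a coloured multinomial inequality

Companion of `…EntropyGameTransfer.lean` (route `PneNP/SymmetryBudget`, items stmt-PneNP-2145 /
stmt-PneNP-14781). The conflict-free colouring produced by the reverse greedy has colours
`c u ≤ |class|`; to turn this into a TYPE-entropy bound (`IsLowEntropy`) one needs a bound on the
multinomial of the colour classes in terms of the colours USED, not of the number of classes:

* `factorial_card_le_coloured`: for a finite set `T` coloured by positive integers,
  `|T|! ≤ (∏_{u ∈ T} 2·c(u)²) · ∏_i |c⁻¹(i) ∩ T|!`
  (Kraft/Gibbs for the code `i ↦ 2 log₂ i + 1`, proved by induction: some colour `i` has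
  `|T| ≤ 2 i² · |c⁻¹ i|` because `∑_i 1/(2i²) ≤ 1`, remove one element of that colour);
* `factorial_le_coloured_univ`: the whole-type form with colour `0` as background:
  `n! ≤ 2ⁿ · (∏_{c u ≠ 0} 2·c(u)²) · ∏_i |c⁻¹ i|!`.

Elementary; no graph theory. [folklore information theory, finite form]
-/

-- `Summit.PneNP.PneNP.…` duplicates `PneNP` BY DESIGN (single-problem summit, D-0017).
set_option linter.dupNamespace false

namespace Summit.PneNP.PneNP.Theorems.CosetGame

open Finset

/-! ### `∑ 1/(2 i²) ≤ 1` -/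

/-- `∑_{i ≤ N} 1/(2 i²) ≤ 1 - 1/(2N)` for `N ≥ 1` (the `i = 0` term is `1/0 = 0`). -/
theorem sum_range_inv_two_sq_le (N : ℕ) (hN : 1 ≤ N) :
    ∑ i ∈ range (N + 1), (1 : ℚ) / (2 * (i : ℚ) ^ 2) ≤ 1 - 1 / (2 * (N : ℚ)) := by
  induction N, hN using Nat.le_induction with
  | base => norm_num [Finset.sum_range_succ]
  | succ N hN ih =>
    rw [Finset.sum_range_succ]
    have hN' : (1 : ℚ) ≤ N := by exact_mod_cast hN
    have key : (1 : ℚ) / (2 * ((N + 1 : ℕ) : ℚ) ^ 2) ≤ 1 / (2 * (N : ℚ)) - 1 / (2 * ((N + 1 : ℕ) : ℚ)) := by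
      push_cast
      rw [div_sub_div _ _ (by positivity) (by positivity), div_le_div_iff₀ (by positivity) (by positivity)]
      nlinarith
    linarith

/-- For every finite set of naturals, `∑_{i ∈ S} 1/(2 i²) ≤ 1`. -/
theorem sum_inv_two_sq_le_one (S : Finset ℕ) : ∑ i ∈ S, (1 : ℚ) / (2 * (i : ℚ) ^ 2) ≤ 1 := by
  set N := max 1 (S.sup id) with hN
  have hsub : S ⊆ range (N + 1) := by
    intro i hi
    rw [Finset.mem_range]
    have : i ≤ S.sup id := Finset.le_sup (f := id) hi
    omega
  calc ∑ i ∈ S, (1 : ℚ) / (2 * (i : ℚ) ^ 2)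
      ≤ ∑ i ∈ range (N + 1), (1 : ℚ) / (2 * (i : ℚ) ^ 2) :=
        Finset.sum_le_sum_of_subset_of_nonneg hsub fun i _ _ => by positivity
    _ ≤ 1 - 1 / (2 * (N : ℚ)) := sum_range_inv_two_sq_le N (le_max_left _ _)
    _ ≤ 1 := by
        have : (0 : ℚ) ≤ 1 / (2 * (N : ℚ)) := by positivity
        linarith

/-! ### A good colour exists -/

variable {α : Type*}

/-- `|T|` is the sum of the sizes of the colour fibres. -/
theorem card_eq_sum_card_fibre [DecidableEq ℕ] (T : Finset α) (c : α → ℕ) {S : Finset ℕ}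
    (hS : T.image c ⊆ S) : T.card = ∑ i ∈ S, (T.filter fun u => c u = i).card :=
  Finset.card_eq_sum_card_fiberwise fun _ hu => hS (Finset.mem_image_of_mem c hu)

/-- **A good colour.** If `T ≠ ∅` is coloured by positive integers then some colour `i` has
`|T| ≤ 2 i² · |c⁻¹ i ∩ T|` (else `|T| = ∑_i |c⁻¹ i| ≤ (|T| - 1) ∑_i 1/(2i²) < |T|`). -/
theorem exists_good_colour (T : Finset α) (c : α → ℕ) {S : Finset ℕ} (hS : T.image c ⊆ S)
    (hc : ∀ u ∈ T, 1 ≤ c u) (hT : T.Nonempty) :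
    ∃ i ∈ S, T.card ≤ 2 * i ^ 2 * (T.filter fun u => c u = i).card := by
  by_contra h
  push Not at h
  have ht : 1 ≤ T.card := Finset.card_pos.2 hT
  -- each fibre: `t_i ≤ (t - 1) · 1/(2 i²)` in `ℚ`
  have hfib : ∀ i ∈ S, ((T.filter fun u => c u = i).card : ℚ) ≤
      ((T.card : ℚ) - 1) * (1 / (2 * (i : ℚ) ^ 2)) := by
    intro i hi
    rcases Nat.eq_zero_or_pos i with rfl | hipos
    · have h0 : (T.filter fun u => c u = 0) = ∅ := by
        rw [Finset.filter_eq_empty_iff]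
        intro u hu hcu
        have := hc u hu
        omega
      rw [h0]
      simp
    · have h2 : (0 : ℚ) < 2 * (i : ℚ) ^ 2 := by positivity
      rw [mul_one_div, le_div_iff₀ h2]
      have hlt : 2 * i ^ 2 * (T.filter fun u => c u = i).card + 1 ≤ T.card := h i hi
      have hq := (Nat.cast_le (α := ℚ)).2 hlt
      push_cast at hq
      have ht' : (1 : ℚ) ≤ T.card := by exact_mod_cast ht
      nlinarith
  have hsum : (T.card : ℚ) ≤ ((T.card : ℚ) - 1) * ∑ i ∈ S, (1 : ℚ) / (2 * (i : ℚ) ^ 2) := by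
    have h1 : (T.card : ℚ) = ∑ i ∈ S, ((T.filter fun u => c u = i).card : ℚ) := by
      rw [card_eq_sum_card_fibre T c hS, Nat.cast_sum]
    conv_lhs => rw [h1]
    rw [Finset.mul_sum]
    exact Finset.sum_le_sum hfib
  have hle1 := sum_inv_two_sq_le_one S
  have ht' : (1 : ℚ) ≤ T.card := by exact_mod_cast ht
  have hnn : (0 : ℚ) ≤ (T.card : ℚ) - 1 := by linarith
  have := mul_le_mul_of_nonneg_left hle1 hnn
  linarith

/-! ### The coloured multinomial inequality -/

variable [DecidableEq α]

/-- Fibres of an erased set. -/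
theorem card_filter_erase (T : Finset α) (c : α → ℕ) {u₀ : α} (hu₀ : u₀ ∈ T) (i : ℕ) :
    ((T.erase u₀).filter fun u => c u = i).card =
      if c u₀ = i then (T.filter fun u => c u = i).card - 1 else (T.filter fun u => c u = i).card := by
  rw [Finset.filter_erase]
  split_ifs with h
  · exact Finset.card_erase_of_mem (Finset.mem_filter.2 ⟨hu₀, h⟩)
  · rw [Finset.erase_eq_of_notMem]
    exact fun hm => h (Finset.mem_filter.1 hm).2

/-- **Coloured multinomial inequality.** For a finite set `T` coloured by positive integers with
colours in `S`: `|T|! ≤ (∏_{u ∈ T} 2·c(u)²) · ∏_{i ∈ S} |c⁻¹(i) ∩ T|!`. Induction on `|T|`: pick a good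
colour `i` (`|T| ≤ 2 i² |c⁻¹ i|`) and remove one element of that colour. -/
theorem factorial_card_le_coloured (S : Finset ℕ) :
    ∀ (n : ℕ) (T : Finset α) (c : α → ℕ), T.card = n → T.image c ⊆ S → (∀ u ∈ T, 1 ≤ c u) →
      n.factorial ≤ (∏ u ∈ T, 2 * c u ^ 2) * ∏ i ∈ S, ((T.filter fun u => c u = i).card).factorial
  | 0 => by
    intro T c hT _ _
    rw [Finset.card_eq_zero] at hT
    subst hT
    simp
  | n + 1 => by
    intro T c hT hS hc
    have hTne : T.Nonempty := Finset.card_pos.1 (by omega)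
    obtain ⟨i, hiS, hi⟩ := exists_good_colour T c hS hc hTne
    -- the good fibre is non-empty
    have hfibpos : 0 < (T.filter fun u => c u = i).card := by
      rcases Nat.eq_zero_or_pos (T.filter fun u => c u = i).card with h0 | h0
      · rw [h0] at hi; omega
      · exact h0
    obtain ⟨u₀, hu₀⟩ := Finset.card_pos.1 hfibpos
    have hu₀T : u₀ ∈ T := (Finset.mem_filter.1 hu₀).1
    have hcu₀ : c u₀ = i := (Finset.mem_filter.1 hu₀).2
    -- induction hypothesis for `T.erase u₀`
    have hT' : (T.erase u₀).card = n := by rw [Finset.card_erase_of_mem hu₀T]; omega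
    have hS' : (T.erase u₀).image c ⊆ S :=
      (Finset.image_subset_image (Finset.erase_subset _ _)).trans hS
    have hc' : ∀ u ∈ T.erase u₀, 1 ≤ c u := fun u hu => hc u (Finset.mem_of_mem_erase hu)
    have IH := factorial_card_le_coloured S n (T.erase u₀) c hT' hS' hc'
    -- split the colour product at `u₀`
    have hprodT : ∏ u ∈ T, 2 * c u ^ 2 = 2 * i ^ 2 * ∏ u ∈ T.erase u₀, 2 * c u ^ 2 := by
      rw [← Finset.mul_prod_erase T (fun u => 2 * c u ^ 2) hu₀T, hcu₀]
    -- fibres away from `i` agree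
    have hrest : ∏ i' ∈ S.erase i, (((T.erase u₀).filter fun u => c u = i').card).factorial =
        ∏ i' ∈ S.erase i, ((T.filter fun u => c u = i').card).factorial := by
      refine Finset.prod_congr rfl fun i' hi' => ?_
      have hne : i' ≠ i := (Finset.mem_erase.1 hi').1
      rw [card_filter_erase T c hu₀T i', if_neg (by rw [hcu₀]; exact hne.symm)]
    -- split the fibre products at the colour `i`
    have hsplitT : ∏ i' ∈ S, ((T.filter fun u => c u = i').card).factorial =
        ((T.filter fun u => c u = i).card).factorial *
          ∏ i' ∈ S.erase i, ((T.filter fun u => c u = i').card).factorial :=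
      (Finset.mul_prod_erase S (fun i' => ((T.filter fun u => c u = i').card).factorial) hiS).symm
    have hsplitT' : ∏ i' ∈ S, (((T.erase u₀).filter fun u => c u = i').card).factorial =
        (((T.erase u₀).filter fun u => c u = i).card).factorial *
          ∏ i' ∈ S.erase i, ((T.filter fun u => c u = i').card).factorial := by
      rw [← Finset.mul_prod_erase S (fun i' => (((T.erase u₀).filter fun u => c u = i').card).factorial)
        hiS, hrest]
    -- the `i`-fibre: `t_i ! = t_i * (t_i - 1)!` and `|fibre of T.erase u₀| = t_i - 1`
    have hFi : ((T.filter fun u => c u = i).card).factorial =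
        (T.filter fun u => c u = i).card * (((T.erase u₀).filter fun u => c u = i).card).factorial := by
      rw [card_filter_erase T c hu₀T i, if_pos hcu₀]
      obtain ⟨m, hm⟩ : ∃ m, (T.filter fun u => c u = i).card = m + 1 := ⟨_, (Nat.succ_pred_eq_of_pos hfibpos).symm⟩
      rw [hm, Nat.add_sub_cancel, Nat.factorial_succ]
    -- assemble
    rw [hsplitT'] at IH
    rw [Nat.factorial_succ, hprodT, hsplitT, hFi]
    have hi' : n + 1 ≤ 2 * i ^ 2 * (T.filter fun u => c u = i).card := hT ▸ hi
    calc (n + 1) * n.factorial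
        ≤ (2 * i ^ 2 * (T.filter fun u => c u = i).card) *
            ((∏ u ∈ T.erase u₀, 2 * c u ^ 2) *
              ((((T.erase u₀).filter fun u => c u = i).card).factorial *
                ∏ i' ∈ S.erase i, ((T.filter fun u => c u = i').card).factorial)) :=
          Nat.mul_le_mul hi' IH
      _ = _ := by ring

/-! ### Whole-type form: colour `0` as background -/

/-- **Whole-type form.** For any colouring `c` of a finite type with `n` elements, with `T = {c ≠ 0}`:
`n! ≤ 2ⁿ · (∏_{u ∈ T} 2·c(u)²) · ∏_{i ∈ image c} |c⁻¹ i|!` — the multinomial of the colour classes is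
at most `2ⁿ ∏_{u ∈ T} 2 c(u)²`. -/
theorem factorial_le_coloured_univ [Fintype α] (c : α → ℕ) :
    (Fintype.card α).factorial ≤
      2 ^ Fintype.card α * (∏ u ∈ Finset.univ.filter (fun u => c u ≠ 0), 2 * c u ^ 2) *
        ∏ i ∈ Finset.univ.image c, ((Finset.univ.filter fun u => c u = i).card).factorial := by
  set T := Finset.univ.filter (fun u : α => c u ≠ 0) with hTdef
  set S := (Finset.univ : Finset α).image c with hSdef
  have hS : T.image c ⊆ S := Finset.image_subset_image (Finset.filter_subset _ _)
  have hc : ∀ u ∈ T, 1 ≤ c u := fun u hu => Nat.one_le_iff_ne_zero.2 (Finset.mem_filter.1 hu).2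
  have hcol := factorial_card_le_coloured S T.card T c rfl hS hc
  -- `n! = C(n,t) · t! · (n-t)!` and `C(n,t) ≤ 2^n`
  have ht : T.card ≤ Fintype.card α := (Finset.card_le_univ T)
  have hchoose := Nat.choose_mul_factorial_mul_factorial ht
  -- fibres over `univ` versus over `T`
  have hfib : (∏ i ∈ S, ((T.filter fun u => c u = i).card).factorial) * (Fintype.card α - T.card).factorial ≤
      ∏ i ∈ S, ((Finset.univ.filter fun u => c u = i).card).factorial := by
    -- for `i ≠ 0` the fibres agree; the `0`-fibre of `T` is empty and that of `univ` is `univ \ T`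
    have hfib_ne : ∀ i, i ≠ 0 → (T.filter fun u => c u = i) = Finset.univ.filter fun u => c u = i := by
      intro i hi
      ext u
      simp only [hTdef, Finset.mem_filter, Finset.mem_univ, true_and]
      constructor
      · exact fun h => h.2
      · intro h; exact ⟨by rw [h]; exact hi, h⟩
    have hfib0T : (T.filter fun u => c u = 0) = ∅ := by
      rw [Finset.filter_eq_empty_iff]
      intro u hu h0
      exact (Finset.mem_filter.1 hu).2 h0
    have hfib0 : (Finset.univ.filter fun u : α => c u = 0).card = Fintype.card α - T.card := by
      have : (Finset.univ.filter fun u : α => c u = 0) = Finset.univ \ T := by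
        ext u
        simp [hTdef]
      rw [this, Finset.card_univ_sdiff]
    by_cases h0 : (0 : ℕ) ∈ S
    · rw [← Finset.mul_prod_erase S _ h0, ← Finset.mul_prod_erase S
        (fun i => ((Finset.univ.filter fun u => c u = i).card).factorial) h0, hfib0T, hfib0,
        Finset.card_empty, Nat.factorial_zero, one_mul]
      have : ∏ x ∈ S.erase 0, ((T.filter fun u => c u = x).card).factorial =
          ∏ x ∈ S.erase 0, ((Finset.univ.filter fun u => c u = x).card).factorial :=
        Finset.prod_congr rfl fun i hi => by rw [hfib_ne i (Finset.mem_erase.1 hi).1]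
      rw [this, mul_comm]
    · -- no vertex has colour `0`: `T = univ`
      have hT : T = Finset.univ := by
        rw [Finset.eq_univ_iff_forall]
        intro u
        rw [hTdef, Finset.mem_filter]
        refine ⟨Finset.mem_univ _, fun hcu => h0 ?_⟩
        rw [hSdef, Finset.mem_image]
        exact ⟨u, Finset.mem_univ _, hcu⟩
      have : Fintype.card α - T.card = 0 := by rw [hT, Finset.card_univ]; omega
      rw [this, Nat.factorial_zero, mul_one]
      refine le_of_eq (Finset.prod_congr rfl fun i hi => ?_)
      have hi0 : i ≠ 0 := fun h => h0 (h ▸ hi)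
      rw [hfib_ne i hi0]
  calc (Fintype.card α).factorial
      = (Fintype.card α).choose T.card * (T.card.factorial * (Fintype.card α - T.card).factorial) := by
        rw [← hchoose, mul_assoc]
    _ ≤ 2 ^ Fintype.card α * (((∏ u ∈ T, 2 * c u ^ 2) *
          ∏ i ∈ S, ((T.filter fun u => c u = i).card).factorial) * (Fintype.card α - T.card).factorial) :=
        Nat.mul_le_mul (Nat.choose_le_two_pow _ _) (Nat.mul_le_mul_right _ hcol)
    _ = 2 ^ Fintype.card α * (∏ u ∈ T, 2 * c u ^ 2) *
          ((∏ i ∈ S, ((T.filter fun u => c u = i).card).factorial) * (Fintype.card α - T.card).factorial) := by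
        ring
    _ ≤ 2 ^ Fintype.card α * (∏ u ∈ T, 2 * c u ^ 2) *
          ∏ i ∈ S, ((Finset.univ.filter fun u => c u = i).card).factorial :=
        Nat.mul_le_mul_left _ hfib

end Summit.PneNP.PneNP.Theorems.CosetGame
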